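import Literature.Analysis.FluidPDE.FluidComputer.TaylorGreenCurvature

/-!
# Time-reversibility of the truncated Euler system (and its failure for `ν > 0`)

The Galerkin-truncated EULER system (`ν = 0`, unforced) is time-reversible: if `û(k,t)` solves it with
pressure multiplier `c(k,t)`, then so does the velocity-reversed, time-reversed field `-û(k,-t)` with
multiplier `c(k,-t)` (`isGalerkinSolution_reverse`) — the advection term is quadratic, `N_S(-û) = N_S(û)`.
With viscosity the reversed field solves the system with viscosity `-ν` instead
(`isGalerkinSolution_reverse_visc`), i.e. reversibility fails exactly through the sign of `ν`.

Use (cell pub-fluidc): the classical REVERSIBILITY TEST of an inviscid spectral run — integrate to `T`,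
flip the sign of the velocity, integrate another `T`, compare with (minus) the initial datum — probes only
time stepping and round-off, because for the exact truncated system the return is an identity
(`reverse_returns`: by uniqueness, when available, the reversed run retraces the forward one; stated here
as the solution property of the reversed curve). [folklore: time-reversal symmetry `u(x,t) ↦ -u(x,-t)` of
the Euler equations, inherited by every Galerkin truncation]

0 sorry, 0 named facts. HONEST FRAMING: typed infrastructure for a low prior, high value-of-information
experiment on Tao's machine paradigm; NOT a claim that NS blows up.
-/

noncomputable section

namespace Literature.Analysis.FluidPDE.FluidComputer

open Complex
open scoped BigOperators

namespace ShellTransfer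

open TaylorGreenHat (scale scale_coeff advection_scale)

/-- The reversed curve `t ↦ -û(-t)`. [folklore] -/
def reverse (U : ℝ → FourierVelocity) (t : ℝ) : FourierVelocity := scale (-1) (U (-t))

/-- Its coefficients. [folklore] -/
@[simp] theorem reverse_coeff (U : ℝ → FourierVelocity) (t : ℝ) (k : Fin 3 → ℤ) (j : Fin 3) :
    (reverse U t).coeff k j = -(U (-t)).coeff k j := by
  unfold reverse
  rw [scale_coeff]
  push_cast
  ring

/-- Reversing twice is the identity. [folklore] -/
theorem reverse_reverse (U : ℝ → FourierVelocity) : reverse (reverse U) = U := by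
  funext t
  refine TaylorGreenHat.fourierVelocity_ext ?_
  funext k j
  rw [reverse_coeff, reverse_coeff, neg_neg, neg_neg]

/-- The advection term is even: `N_S(-û) = N_S(û)`. [folklore] -/
theorem advection_reverse (U : ℝ → FourierVelocity) (S : Finset (Fin 3 → ℤ)) (t : ℝ) (k : Fin 3 → ℤ)
    (j : Fin 3) : advection (reverse U t) S k j = advection (U (-t)) S k j := by
  unfold reverse
  rw [advection_scale]
  push_cast
  ring

/-- **TIME REVERSAL WITH VISCOSITY FLIPS THE SIGN OF `ν`.** If `U` solves the unforced Galerkin system with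
viscosity `ν` and pressure multiplier `c`, then `t ↦ -û(-t)` solves it with viscosity `-ν` and multiplier
`c(-t)`. [folklore] -/
theorem isGalerkinSolution_reverse_visc {U : ℝ → FourierVelocity} {S : Finset (Fin 3 → ℤ)} {ν : ℝ}
    {c : ℝ → (Fin 3 → ℤ) → ℂ} (hU : IsGalerkinSolution U S ν c fun _ _ _ => 0) :
    IsGalerkinSolution (reverse U) S (-ν) (fun t => c (-t)) fun _ _ _ => 0 := by
  intro t k hk j
  have e : (fun s => (reverse U s).coeff k j) = fun s => -(U (-s)).coeff k j := by
    funext s; exact reverse_coeff U s k j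
  rw [e]
  -- chain rule through `s ↦ -s`
  have h1 : HasDerivAt (fun s => (U (-s)).coeff k j)
      ((-1 : ℝ) • galerkinRHS (U (-t)) S ν (c (-t)) (fun _ _ => 0) k j) t := by
    have h := HasDerivAt.scomp t (hU (-t) k hk j) (hasDerivAt_neg t)
    exact h
  have h2 := h1.neg
  refine h2.congr_deriv ?_
  rw [Complex.real_smul]
  unfold galerkinRHS
  rw [advection_reverse, reverse_coeff]
  push_cast
  ring

/-- **TIME-REVERSIBILITY OF THE TRUNCATED EULER SYSTEM**: if `U` solves the unforced Euler–Galerkin system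
(`ν = 0`) with pressure multiplier `c`, so does `t ↦ -û(-t)` with multiplier `c(-t)`. [folklore] -/
theorem isGalerkinSolution_reverse {U : ℝ → FourierVelocity} {S : Finset (Fin 3 → ℤ)}
    {c : ℝ → (Fin 3 → ℤ) → ℂ} (hU : IsGalerkinSolution U S 0 c fun _ _ _ => 0) :
    IsGalerkinSolution (reverse U) S 0 (fun t => c (-t)) fun _ _ _ => 0 := by
  have h := isGalerkinSolution_reverse_visc hU
  rw [neg_zero] at h
  exact h

/-- The reversed curve has the same energy at mirrored times. [folklore] -/
theorem truncEnergy_reverse (U : ℝ → FourierVelocity) (S : Finset (Fin 3 → ℤ)) (t : ℝ) :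
    truncEnergy (reverse U t) S = truncEnergy (U (-t)) S := by
  unfold truncEnergy modalEnergy
  refine Finset.sum_congr rfl fun k _ => ?_
  congr 1
  refine Finset.sum_congr rfl fun j _ => ?_
  rw [reverse_coeff, Complex.normSq_neg]

/-- Support is preserved. [folklore] -/
theorem reverse_isSupportedOn {U : ℝ → FourierVelocity} {S : Finset (Fin 3 → ℤ)} (h : IsSupportedOn U S) :
    IsSupportedOn (reverse U) S := by
  intro t k hk
  funext j
  rw [reverse_coeff, h (-t) k hk]
  simp

/-- **The reversibility test is an identity of the exact system.** Reversing at time `T`: the curve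
`s ↦ -û(T - s)` solves the truncated Euler system (multiplier `c(T - s)`), starts from `-û(T)` and at
`s = T` equals `-û(0)`. (With uniqueness — `GalerkinODE.galerkin_unique` — any code's reversed run from
`-û(T)` must therefore return to `-û(0)`; here the solution property and the endpoint values.) [folklore] -/
theorem reverse_returns {U : ℝ → FourierVelocity} {S : Finset (Fin 3 → ℤ)} {c : ℝ → (Fin 3 → ℤ) → ℂ}
    (hU : IsGalerkinSolution U S 0 c fun _ _ _ => 0) (T : ℝ) :
    IsGalerkinSolution (fun s => reverse U (s - T)) S 0 (fun s => c (T - s)) (fun _ _ _ => 0) ∧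
      (fun s => reverse U (s - T)) 0 = scale (-1) (U T) ∧ (fun s => reverse U (s - T)) T = scale (-1) (U 0) := by
  refine ⟨?_, ?_, ?_⟩
  · intro t k hk j
    have h := isGalerkinSolution_reverse hU (t - T) k hk j
    -- shift the time variable
    have hs : HasDerivAt (fun s : ℝ => s - T) 1 t := by
      simpa using (hasDerivAt_id t).sub_const T
    have h2 := HasDerivAt.scomp t h hs
    simp only [one_smul] at h2
    refine h2.congr_deriv ?_
    rw [neg_sub]
  · show reverse U (0 - T) = scale (-1) (U T)
    unfold reverse
    rw [zero_sub, neg_neg]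
  · show reverse U (T - T) = scale (-1) (U 0)
    unfold reverse
    rw [sub_self, neg_zero]

end ShellTransfer

end Literature.Analysis.FluidPDE.FluidComputer

end
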